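import Summits.Ventures.Crystal3D.Theorems.StickyWulffConstantCoaxialWallLawWordCoreStateInv
import Summits.Ventures.Crystal3D.Theorems.StickyWulffConstantCoaxialWallLawWordInstance
import Summits.Ventures.Crystal3D.Theorems.StickyWulffConstantGenericWallFloorStarLemma
import HarnessLib

/-!
# The plane invariant of the word automaton: translation pairs (v2, NO band, NO residual)

HONEST FRAMING. Part of the venture `Summits/Ventures/Crystal3D` (cell `crystal3d-full`), helper for the
crux `CoaxialWallLaw` (stmt-Ventures-19481) of `route-Ventures-StickyWulffConstant`, REGISTERED line
`WallLedgerF` (planner cf-p1 gen 16), open stub `stub_coaxialTwoSlabAdhesion` (general fillings).  Brick W11a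
of the v2 (NET) line automaton (memo F-NET-TRANSLATIONS, 19481-p2 g2): TRANSLATION pairs — the two grains
`G₀·Λ₀ + t₁`, `G₀·Λ₀ + t₂` have the SAME frame, so the top sample cannot be told apart from the bottom grain by a
class; instead a POSITION invariant shows that no line of the automaton ever reaches the top coset.  Rung credit
only; F-C1 not moved.

THE PLANE INVARIANT.  Root the automaton at a slot `w` and let `s` be a slot ORTHOGONAL to `w`.  A letter
pushed onto a word `κ` is a model menu normal `ν` with `⟪u κ, ν⟫ = √(2/3)`, and `u κ = ±w`; no unit model menu
normal is oblique to two orthogonal slots at once (`menuNormal_inner_eq_zero_of_orth`: `⟪ν, w⟫, ⟪ν, s⟫ = ±√(2/3)`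
would give `⟪±w ± s, ν⟫ = 2√(2/3) > √2 = ‖w ± s‖`), so EVERY letter of every class is orthogonal to `s`; the
frame of a class is `G₀` composed with mirrors in vectors orthogonal to `s`, which preserve `⟪·, s⟫`
(`inner_foldl_reflect_eq_of_orth`); hence every move changes `⟪G₀⁻¹(ball − t₁), s⟫` by `⟪±w, s⟫ = 0`, and along the
automaton `⟪G₀⁻¹(b − t₁), s⟫ ∈ ½ℤ` (`inner_fcc_slot_half_int`: lattice vectors pair with slots in `½ℤ`).  If the
offset is SKEW, `2⟪G₀⁻¹(t₂ − t₁), s⟫ ∉ ℤ`, no state of the automaton sits on a ball of the top coset.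

**Theorem (`word_sources_le_lists_plane`).**  Word data as in `word_sources_le_lists` (any root slot `u []`,
well-formed words, `next` by push/pop), a slot `s ⊥ u []`, the two-slab cell with bottom sample in
`F []·Λ₀ + t₁` and top sample in `F []·Λ₀ + t₂`, skew offset, rising root direction.  Then the vertical tops of
the inner bottom sample along `F [] (u [])` are at most `13·220·#{deg ≤ 11 in the window} + 220·#rim_top +
220·#rim_bottom` — NO band term, NO residual, no condition on the inclination (19481-p1's band-free count
`word_sources_le_of_stateInvariant` with this state invariant; classes, certified states, move map and rigidity
from `…WordInstance` / `…WordStates` / `…WordRigidity`).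

WHAT THIS IS NOT: not the stub (the cell assembly and the capstone for translation pairs are the next bricks;
offsets with `2⟪G₀⁻¹(t₂ − t₁), s⟫ ∈ ℤ` for the chosen root are not covered by that root); F-C1 not moved.
-/

noncomputable section

namespace Summit.Ventures.Crystal3D.Theorems

open Summit.Ventures.Crystal3D Finset NearIdentity
open Literature.MathematicalPhysics.StatisticalMechanics (fccStacking)
open scoped InnerProductSpace

/-- Mirrors in vectors orthogonal to `s` preserve the pairing with `s`. -/
theorem inner_foldl_reflect_eq_of_orth (s : EuclideanSpace ℝ (Fin 3)) :
    ∀ (κ : List (EuclideanSpace ℝ (Fin 3))), (∀ μ ∈ κ, ⟪μ, s⟫_ℝ = 0) → ∀ x : EuclideanSpace ℝ (Fin 3),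
      ⟪κ.foldl (fun (y : EuclideanSpace ℝ (Fin 3)) μ => y - (2 * ⟪y, μ⟫_ℝ) • μ) x, s⟫_ℝ = ⟪x, s⟫_ℝ := by
  intro κ
  induction κ with
  | nil => intro _ x; rfl
  | cons μ κ ih =>
    intro hκ x
    have hμ : ⟪μ, s⟫_ℝ = 0 := hκ μ (by simp)
    rw [List.foldl_cons, ih (fun ν hν => hκ ν (by simp [hν])), inner_sub_left, real_inner_smul_left, hμ, mul_zero,
      sub_zero]

/-- **No model menu normal is oblique to two orthogonal slots.**  If `w ⊥ s` are slots and `ν` is a unit model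
menu normal with `⟪w, ν⟫ ≠ 0`, then `⟪ν, s⟫ = 0`. -/
theorem menuNormal_inner_eq_zero_of_orth {w s ν : EuclideanSpace ℝ (Fin 3)} (hw : w ∈ fccSlots) (hs : s ∈ fccSlots)
    (hws : ⟪w, s⟫_ℝ = 0) (hν : ‖ν‖ = 1)
    (hmenu : ∀ v ∈ fccSlots, ⟪v, ν⟫_ℝ = 0 ∨ ⟪v, ν⟫_ℝ = Real.sqrt (2 / 3) ∨ ⟪v, ν⟫_ℝ = -Real.sqrt (2 / 3))
    (hwν : ⟪w, ν⟫_ℝ ≠ 0) : ⟪ν, s⟫_ℝ = 0 := by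
  have hr : 0 < Real.sqrt (2 / 3) := Real.sqrt_pos.2 (by norm_num)
  have hr2 : Real.sqrt (2 / 3) ^ 2 = 2 / 3 := Real.sq_sqrt (by norm_num)
  have hnw : ‖w‖ = 1 := norm_eq_one_of_mem_fccSlots hw
  have hns : ‖s‖ = 1 := norm_eq_one_of_mem_fccSlots hs
  rw [real_inner_comm]
  by_contra hsν
  -- signs `ε, ε'` with `⟪ε w, ν⟫ = ⟪ε' s, ν⟫ = √(2/3)`
  obtain ⟨ε, hε, hεw⟩ : ∃ ε : ℝ, ε ^ 2 = 1 ∧ ⟪ε • w, ν⟫_ℝ = Real.sqrt (2 / 3) := by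
    rcases hmenu w hw with h | h | h
    · exact absurd h hwν
    · exact ⟨1, by norm_num, by rw [one_smul, h]⟩
    · exact ⟨-1, by norm_num, by rw [neg_one_smul, inner_neg_left, h, neg_neg]⟩
  obtain ⟨ε', hε', hε's⟩ : ∃ ε' : ℝ, ε' ^ 2 = 1 ∧ ⟪ε' • s, ν⟫_ℝ = Real.sqrt (2 / 3) := by
    rcases hmenu s hs with h | h | h
    · exact absurd h hsν
    · exact ⟨1, by norm_num, by rw [one_smul, h]⟩
    · exact ⟨-1, by norm_num, by rw [neg_one_smul, inner_neg_left, h, neg_neg]⟩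
  -- the vector `v = ε w + ε' s` has `‖v‖² = 2` and `⟪v, ν⟫ = 2√(2/3)`, contradicting Cauchy–Schwarz
  set v : EuclideanSpace ℝ (Fin 3) := ε • w + ε' • s with hv
  have hvν : ⟪v, ν⟫_ℝ = 2 * Real.sqrt (2 / 3) := by rw [hv, inner_add_left, hεw, hε's]; ring
  have hvn : ‖v‖ ^ 2 = 2 := by
    rw [hv, @norm_add_sq_real, norm_smul, norm_smul, hnw, hns, real_inner_smul_left, real_inner_smul_right, hws,
      Real.norm_eq_abs, Real.norm_eq_abs, mul_one, mul_one, sq_abs, sq_abs, hε, hε']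
    ring
  have hcs := abs_real_inner_le_norm v ν
  rw [hν, mul_one, hvν] at hcs
  have h1 : (2 * Real.sqrt (2 / 3)) ^ 2 ≤ ‖v‖ ^ 2 := by
    have h0 : 0 ≤ 2 * Real.sqrt (2 / 3) := by positivity
    rw [abs_of_nonneg h0] at hcs
    exact pow_le_pow_left₀ h0 hcs 2
  rw [hvn, mul_pow, hr2] at h1
  norm_num at h1

/-- **Lattice vectors pair with slots in `½ℤ`.** -/
theorem inner_fcc_slot_half_int {x s : EuclideanSpace ℝ (Fin 3)} (hx : x ∈ fccStacking 1 (Real.sqrt (2 / 3)))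
    (hs : s ∈ fccSlots) : ∃ z : ℤ, ⟪x, s⟫_ℝ = (z : ℝ) / 2 := by
  obtain ⟨i, j, k, rfl⟩ := exists_zsum_slots_of_mem_fcc hx
  obtain ⟨l, rfl⟩ := exists_slotSite_eq hs
  refine ⟨i * (slotInt 0 ⬝ᵥ slotInt l) + j * (slotInt 4 ⬝ᵥ slotInt l) + k * (slotInt 8 ⬝ᵥ slotInt l), ?_⟩
  rw [inner_add_left, inner_add_left, real_inner_smul_left, real_inner_smul_left, real_inner_smul_left,
    inner_slotSite, inner_slotSite, inner_slotSite]
  push_cast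
  ring

section Instance

variable {X : Finset (EuclideanSpace ℝ (Fin 3))}
  {F : List (EuclideanSpace ℝ (Fin 3)) → (EuclideanSpace ℝ (Fin 3) ≃ₗᵢ[ℝ] EuclideanSpace ℝ (Fin 3))}
  {u : List (EuclideanSpace ℝ (Fin 3)) → EuclideanSpace ℝ (Fin 3)}
  {WF : List (EuclideanSpace ℝ (Fin 3)) → Prop}
  {next : List (EuclideanSpace ℝ (Fin 3)) → EuclideanSpace ℝ (Fin 3) → List (EuclideanSpace ℝ (Fin 3))}
  {P₁ P' P₂ : Finset (EuclideanSpace ℝ (Fin 3))} {t₁ t₂ : EuclideanSpace ℝ (Fin 3)} {R₀ h ρ : ℝ}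

open scoped Classical in
/-- **The band-free NET count for TRANSLATION pairs (plane invariant).**  See the module docstring. -/
theorem word_sources_le_lists_plane {δ : ℝ} (hg : KissingGap δ) (hc : KissingClassification δ)
    (hX : ∀ p ∈ X, ∀ q ∈ X, p ≠ q → 1 ≤ dist p q)
    (hFc : ∀ μ κ, F (μ :: κ) = ((ℝ ∙ μ)ᗮ.reflection).trans (F κ))
    (hu : ∀ κ, u κ ∈ fccSlots) (huc : ∀ μ κ, u (μ :: κ) = -u κ)
    (hWF0 : WF [])
    (hWFc : ∀ μ κ, WF (μ :: κ) ↔ (WF κ ∧ ‖μ‖ = 1 ∧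
      (∀ w ∈ fccSlots, ⟪w, μ⟫_ℝ = 0 ∨ ⟪w, μ⟫_ℝ = Real.sqrt (2 / 3) ∨ ⟪w, μ⟫_ℝ = -Real.sqrt (2 / 3)) ∧
      ⟪u κ, μ⟫_ℝ = Real.sqrt (2 / 3) ∧ ∀ μ' κ', κ = μ' :: κ' → μ' ≠ -μ))
    (hnext_pop : ∀ μ κ' (m : EuclideanSpace ℝ (Fin 3)), (F (μ :: κ')).symm m = -μ → next (μ :: κ') m = κ')
    (hnext_push : ∀ κ (m : EuclideanSpace ℝ (Fin 3)), (∀ μ κ', κ = μ :: κ' → (F κ).symm m ≠ -μ) →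
      next κ m = (F κ).symm m :: κ)
    -- the orthogonal slot and the skew offset
    {s : EuclideanSpace ℝ (Fin 3)} (hs : s ∈ fccSlots) (hus : ⟪u [], s⟫_ℝ = 0)
    (hskew : ∀ z : ℤ, ⟪(F []).symm (t₂ - t₁), s⟫_ℝ ≠ (z : ℝ) / 2)
    (hup : 0 < (F [] (u [])) 2)
    -- the cell
    (hR₀ : 3 ≤ R₀) (hρ : R₀ ≤ ρ)
    (hcell : ∀ p ∈ X, -(2 * R₀) ≤ p 2 ∧ p 2 ≤ h + 2 * R₀ ∧ p 0 ^ 2 + p 1 ^ 2 ≤ ρ ^ 2)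
    (hP₁X : P₁ ⊆ X) (hP₂X : P₂ ⊆ X)
    (hP₁ : ∀ p, p ∈ P₁ ↔ (p ∈ (fun q => F [] q + t₁) '' fccStacking 1 (Real.sqrt (2 / 3)) ∧
      -(2 * R₀) ≤ p 2 ∧ p 2 ≤ -R₀ ∧ p 0 ^ 2 + p 1 ^ 2 ≤ ρ ^ 2))
    (hP' : ∀ p, p ∈ P' ↔ (p ∈ (fun q => F [] q + t₁) '' fccStacking 1 (Real.sqrt (2 / 3)) ∧
      -(2 * R₀) + 1 ≤ p 2 ∧ p 2 ≤ -R₀ - 1 ∧ p 0 ^ 2 + p 1 ^ 2 ≤ (ρ - 1) ^ 2))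
    (hP'full : ∀ p ∈ P', ∀ w ∈ fccSlots, p + F [] w ∈ X)
    (hP₂ : ∀ p, p ∈ P₂ ↔ (p ∈ (fun q => F [] q + t₂) '' fccStacking 1 (Real.sqrt (2 / 3)) ∧
      h + R₀ ≤ p 2 ∧ p 2 ≤ h + 2 * R₀ ∧ p 0 ^ 2 + p 1 ^ 2 ≤ ρ ^ 2)) :
    (P'.filter fun p => (∀ w ∈ fccSlots, p + F [] w ∈ X) ∧
        -R₀ - 1 < (p + F [] (u [])) 2 ∧ (p + F [] (u [])) 2 < h + R₀ + 1).card ≤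
      13 * 220 * (X.filter fun z => (X.filter fun q => dist z q = 1).card ≤ 11 ∧
          -R₀ - 1 - 1 ≤ z 2 ∧ z 2 ≤ h + R₀ + 1 + 1).card +
      220 * (X.filter fun s => h + R₀ + 1 ≤ s 2 ∧ s 2 ≤ h + R₀ + 1 + 1 ∧ (ρ - 2) ^ 2 < s 0 ^ 2 + s 1 ^ 2).card +
      220 * (X.filter fun s => -R₀ - 1 - 1 ≤ s 2 ∧ s 2 < -R₀ - 1 ∧ (ρ - 1) ^ 2 < s 0 ^ 2 + s 1 ^ 2).card := by
  have hr : 0 < Real.sqrt (2 / 3) := Real.sqrt_pos.2 (by norm_num)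
  -- the class data on the subtype of well-formed words
  set F' : {κ : List (EuclideanSpace ℝ (Fin 3)) // WF κ} →
      (EuclideanSpace ℝ (Fin 3) ≃ₗᵢ[ℝ] EuclideanSpace ℝ (Fin 3)) := fun κ => F κ.1 with hF'
  set d' : {κ : List (EuclideanSpace ℝ (Fin 3)) // WF κ} → EuclideanSpace ℝ (Fin 3) :=
    fun κ => F κ.1 (u κ.1) with hd'
  set next' : {κ : List (EuclideanSpace ℝ (Fin 3)) // WF κ} → EuclideanSpace ℝ (Fin 3) →
      {κ : List (EuclideanSpace ℝ (Fin 3)) // WF κ} := fun κ m =>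
    @dite _ (WF (next κ.1 m)) (Classical.propDecidable _) (fun hw => ⟨next κ.1 m, hw⟩) (fun _ => κ) with hnext'
  set root : {κ : List (EuclideanSpace ℝ (Fin 3)) // WF κ} := ⟨[], hWF0⟩ with hroot_def
  -- the class change along a crossing normal
  have hspec : ∀ (κ : {κ : List (EuclideanSpace ℝ (Fin 3)) // WF κ}) (m : EuclideanSpace ℝ (Fin 3)), ‖m‖ = 1 →
      (∀ w ∈ fccSlots, ⟪F' κ w, m⟫_ℝ = 0 ∨ ⟪F' κ w, m⟫_ℝ = Real.sqrt (2 / 3) ∨ ⟪F' κ w, m⟫_ℝ = -Real.sqrt (2 / 3)) →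
      ⟪d' κ, m⟫_ℝ = Real.sqrt (2 / 3) →
      (next' κ m).1 = next κ.1 m ∧ (∀ x, F (next κ.1 m) x = F κ.1 x - (2 * ⟪F κ.1 x, m⟫_ℝ) • m) ∧
        ⟪F (next κ.1 m) (u (next κ.1 m)), m⟫_ℝ = Real.sqrt (2 / 3) ∧ next (next κ.1 m) m = κ.1 := by
    intro κ m hm hmenu hdm
    obtain ⟨hwf, hfr, hdir, hinv⟩ := word_next_spec hFc huc hWFc hnext_pop hnext_push κ.2 hm hmenu hdm
    refine ⟨?_, hfr, hdir, hinv⟩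
    simp only [hnext']
    rw [dif_pos hwf]
  have hmirror : ∀ (κ : {κ : List (EuclideanSpace ℝ (Fin 3)) // WF κ}) (m : EuclideanSpace ℝ (Fin 3)), ‖m‖ = 1 →
      (∀ w ∈ fccSlots, ⟪F' κ w, m⟫_ℝ = 0 ∨ ⟪F' κ w, m⟫_ℝ = Real.sqrt (2 / 3) ∨ ⟪F' κ w, m⟫_ℝ = -Real.sqrt (2 / 3)) →
      ⟪d' κ, m⟫_ℝ = Real.sqrt (2 / 3) → ∀ x, F' (next' κ m) x = F' κ x - (2 * ⟪F' κ x, m⟫_ℝ) • m := by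
    intro κ m hm hmenu hdm x
    obtain ⟨h1, hfr, -, -⟩ := hspec κ m hm hmenu hdm
    show F (next' κ m).1 x = F κ.1 x - (2 * ⟪F κ.1 x, m⟫_ℝ) • m
    rw [h1]; exact hfr x
  have hinv : ∀ (κ : {κ : List (EuclideanSpace ℝ (Fin 3)) // WF κ}) (m : EuclideanSpace ℝ (Fin 3)), ‖m‖ = 1 →
      (∀ w ∈ fccSlots, ⟪F' κ w, m⟫_ℝ = 0 ∨ ⟪F' κ w, m⟫_ℝ = Real.sqrt (2 / 3) ∨ ⟪F' κ w, m⟫_ℝ = -Real.sqrt (2 / 3)) →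
      ⟪d' κ, m⟫_ℝ = Real.sqrt (2 / 3) → next' (next' κ m) m = κ := by
    intro κ m hm hmenu hdm
    obtain ⟨h1, -, -, hback⟩ := hspec κ m hm hmenu hdm
    apply Subtype.ext
    have h2 : (next' (next' κ m) m).1 = next (next' κ m).1 m := by
      simp only [hnext']
      rw [dif_pos]
      rw [h1, hback]; exact κ.2
    rw [h2, h1, hback]
  have hdnext : ∀ (κ : {κ : List (EuclideanSpace ℝ (Fin 3)) // WF κ}) (m : EuclideanSpace ℝ (Fin 3)), ‖m‖ = 1 →
      (∀ w ∈ fccSlots, ⟪F' κ w, m⟫_ℝ = 0 ∨ ⟪F' κ w, m⟫_ℝ = Real.sqrt (2 / 3) ∨ ⟪F' κ w, m⟫_ℝ = -Real.sqrt (2 / 3)) →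
      ⟪d' κ, m⟫_ℝ = Real.sqrt (2 / 3) → ⟪d' (next' κ m), m⟫_ℝ = Real.sqrt (2 / 3) := by
    intro κ m hm hmenu hdm
    obtain ⟨h1, -, hdir, -⟩ := hspec κ m hm hmenu hdm
    show ⟪F (next' κ m).1 (u (next' κ m).1), m⟫_ℝ = Real.sqrt (2 / 3)
    rw [h1]; exact hdir
  have hd : ∀ κ : {κ : List (EuclideanSpace ℝ (Fin 3)) // WF κ}, ∃ u' ∈ fccSlots, d' κ = F' κ u' :=
    fun κ => ⟨u κ.1, hu κ.1, rfl⟩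
  have hdn : ∀ κ : {κ : List (EuclideanSpace ℝ (Fin 3)) // WF κ}, ∃ m : EuclideanSpace ℝ (Fin 3), ‖m‖ = 1 ∧
      (∀ w ∈ fccSlots, ⟪F' κ w, m⟫_ℝ = 0 ∨ ⟪F' κ w, m⟫_ℝ = Real.sqrt (2 / 3) ∨ ⟪F' κ w, m⟫_ℝ = -Real.sqrt (2 / 3)) ∧
      ⟪d' κ, m⟫_ℝ = Real.sqrt (2 / 3) := fun κ => exists_menuNormal_far (F κ.1) (hu κ.1)
  -- rigidity: the slot dozen determines the word
  have hinjK : ∀ κ κ' : {κ : List (EuclideanSpace ℝ (Fin 3)) // WF κ},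
      (F' κ : EuclideanSpace ℝ (Fin 3) → EuclideanSpace ℝ (Fin 3)) '' ↑fccSlots =
      (F' κ' : EuclideanSpace ℝ (Fin 3) → EuclideanSpace ℝ (Fin 3)) '' ↑fccSlots → κ = κ' :=
    fun κ κ' himg => Subtype.ext (word_eq_of_image_eq hFc huc hWFc κ.2 κ'.2 himg)
  have hrig : ∀ κ κ' : {κ : List (EuclideanSpace ℝ (Fin 3)) // WF κ},
      (∃ a ∈ fccSlots, ∃ a' ∈ fccSlots, ∃ a'' ∈ fccSlots,
        ⟪a, a'⟫_ℝ = 1 / 2 ∧ ⟪a, a''⟫_ℝ = 1 / 2 ∧ ⟪a', a''⟫_ℝ = 1 / 2 ∧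
        (∃ w ∈ fccSlots, F' κ' w = F' κ a) ∧ (∃ w ∈ fccSlots, F' κ' w = F' κ a') ∧
        (∃ w ∈ fccSlots, F' κ' w = F' κ a'')) → κ = κ' :=
    fun κ κ' htri => Subtype.ext (word_eq_of_triangle hFc huc hWFc κ.2 κ'.2 htri)
  -- the certified states and the move map
  obtain ⟨W, hW, hmult⟩ := exists_certified_states (F := F') (d := d') hX hinjK
  obtain ⟨f, hf_full, hf_cross, hf_glide⟩ := exists_word_move_map X F' d' next'
  -- THE PLANE INVARIANT
  set Ps : EuclideanSpace ℝ (Fin 3) × {κ : List (EuclideanSpace ℝ (Fin 3)) // WF κ} → Prop := fun v =>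
    (∀ μ ∈ v.2.1, ⟪μ, s⟫_ℝ = 0) ∧ ∃ z : ℤ, ⟪(F []).symm (v.1 - t₁), s⟫_ℝ = (z : ℝ) / 2 with hPs
  -- (i) letters: every letter of a well-formed word extending an `s`-orthogonal word stays `s`-orthogonal
  have hletters : ∀ μ ∈ ([] : List (EuclideanSpace ℝ (Fin 3))), ⟪μ, s⟫_ℝ = 0 := fun μ hμ => by simp at hμ
  have husign : ∀ κ : List (EuclideanSpace ℝ (Fin 3)), u κ = u [] ∨ u κ = -u [] := by
    intro κ
    induction κ with
    | nil => exact Or.inl rfl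
    | cons μ κ ih =>
      rw [huc]
      rcases ih with h | h
      · exact Or.inr (by rw [h])
      · exact Or.inl (by rw [h, neg_neg])
  have hus' : ∀ κ : List (EuclideanSpace ℝ (Fin 3)), ⟪u κ, s⟫_ℝ = 0 := by
    intro κ
    rcases husign κ with h | h
    · rw [h, hus]
    · rw [h, inner_neg_left, hus, neg_zero]
  have hnext_letters : ∀ (κ : {κ : List (EuclideanSpace ℝ (Fin 3)) // WF κ}) (m : EuclideanSpace ℝ (Fin 3)),
      ‖m‖ = 1 →
      (∀ w ∈ fccSlots, ⟪F' κ w, m⟫_ℝ = 0 ∨ ⟪F' κ w, m⟫_ℝ = Real.sqrt (2 / 3) ∨ ⟪F' κ w, m⟫_ℝ = -Real.sqrt (2 / 3)) →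
      ⟪d' κ, m⟫_ℝ = Real.sqrt (2 / 3) → (∀ μ ∈ κ.1, ⟪μ, s⟫_ℝ = 0) → ∀ μ ∈ next κ.1 m, ⟪μ, s⟫_ℝ = 0 := by
    intro κ m hm hmenu hdm hκ μ hμ
    by_cases hpop : ∃ μ₀ κ', κ.1 = μ₀ :: κ' ∧ (F κ.1).symm m = -μ₀
    · obtain ⟨μ₀, κ', hκeq, hν⟩ := hpop
      have hn : next κ.1 m = κ' := by rw [hκeq]; rw [hκeq] at hν; exact hnext_pop μ₀ κ' m hν
      rw [hn] at hμ
      exact hκ μ (by rw [hκeq]; exact List.mem_cons_of_mem _ hμ)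
    · push Not at hpop
      have hn : next κ.1 m = (F κ.1).symm m :: κ.1 := hnext_push κ.1 m fun μ₀ κ' h => hpop μ₀ κ' h
      rw [hn] at hμ
      rcases List.mem_cons.1 hμ with rfl | hμ
      · -- the new letter is oblique to `u κ = ±u []`, hence orthogonal to `s`
        obtain ⟨hν1, hνmenu, hνu, -⟩ := word_letter_props (F := F) (u := u) κ.1 hm hmenu hdm
        have hwν : ⟪u [], (F κ.1).symm m⟫_ℝ ≠ 0 := by
          rcases husign κ.1 with h | h
          · rw [← h, hνu]; exact hr.ne'
          · have : ⟪u [], (F κ.1).symm m⟫_ℝ = -Real.sqrt (2 / 3) := by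
              have h' := hνu; rw [h, inner_neg_left] at h'; linarith
            rw [this]; exact neg_ne_zero.2 hr.ne'
        exact menuNormal_inner_eq_zero_of_orth (hu []) hs hus hν1 hνmenu hwν
      · exact hκ μ hμ
  -- (ii) positions: a move along the direction of an `s`-orthogonal class keeps `⟪G₀⁻¹(b − t₁), s⟫`
  have hmove : ∀ (b : EuclideanSpace ℝ (Fin 3)) (κ : {κ : List (EuclideanSpace ℝ (Fin 3)) // WF κ}),
      (∀ μ ∈ κ.1, ⟪μ, s⟫_ℝ = 0) →
      ⟪(F []).symm (b + d' κ - t₁), s⟫_ℝ = ⟪(F []).symm (b - t₁), s⟫_ℝ := by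
    intro b κ hκ
    obtain ⟨hlet, -⟩ := word_letters_of_wf huc hWFc κ.1 κ.2
    have hκu : ∀ μ ∈ κ.1, ‖μ‖ = 1 := fun μ hμ => (hlet μ hμ).1
    have e1 : d' κ = F [] (κ.1.foldl (fun (y : EuclideanSpace ℝ (Fin 3)) μ => y - (2 * ⟪y, μ⟫_ℝ) • μ) (u κ.1)) := by
      have := word_F_append_apply hFc κ.1 hκu [] (u κ.1)
      rw [List.append_nil] at this
      exact this
    rw [show b + d' κ - t₁ = (b - t₁) + d' κ by abel, map_add, e1, LinearIsometryEquiv.symm_apply_apply,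
      inner_add_left, inner_foldl_reflect_eq_of_orth s κ.1 hκ, hus', add_zero]
  -- (iii) the invariant along the automaton
  have hPsrc : ∀ p ∈ P', (∀ w ∈ fccSlots, p + F' root w ∈ X) → Ps (p + d' root, root) := by
    intro p hp _
    refine ⟨hletters, ?_⟩
    obtain ⟨⟨q, hq, hpq⟩, -, -, -⟩ := (hP' p).1 hp
    obtain ⟨z, hz⟩ := inner_fcc_slot_half_int hq hs
    refine ⟨z, ?_⟩
    show ⟪(F []).symm (p + d' root - t₁), s⟫_ℝ = (z : ℝ) / 2
    rw [hmove p root hletters, ← hpq, add_sub_cancel_right, LinearIsometryEquiv.symm_apply_apply, hz]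
  have hPfull : ∀ v ∈ W, Ps v → Ps (v.1 + d' v.2, v.2) := by
    rintro v - ⟨hκ, z, hz⟩
    exact ⟨hκ, z, by rw [hmove v.1 v.2 hκ, hz]⟩
  have hPcross : ∀ v ∈ W, ∀ m : EuclideanSpace ℝ (Fin 3), ‖m‖ = 1 →
      (∀ w ∈ fccSlots, ⟪F' v.2 w, m⟫_ℝ = 0 ∨ ⟪F' v.2 w, m⟫_ℝ = Real.sqrt (2 / 3) ∨ ⟪F' v.2 w, m⟫_ℝ = -Real.sqrt (2 / 3)) →
      ⟪d' v.2, m⟫_ℝ = Real.sqrt (2 / 3) → Ps v → Ps (v.1 + d' (next' v.2 m), next' v.2 m) := by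
    rintro v - m hm hmenu hdm ⟨hκ, z, hz⟩
    obtain ⟨h1, -, -, -⟩ := hspec v.2 m hm hmenu hdm
    have hκ' : ∀ μ ∈ (next' v.2 m).1, ⟪μ, s⟫_ℝ = 0 := by
      rw [h1]; exact hnext_letters v.2 m hm hmenu hdm hκ
    exact ⟨hκ', z, by rw [hmove v.1 (next' v.2 m) hκ', hz]⟩
  have hPtop : ∀ v ∈ W, Ps v → v.1 ∉ P₂ := by
    rintro v - ⟨-, z, hz⟩ hvP
    obtain ⟨⟨q, hq, hpq⟩, -, -, -⟩ := (hP₂ v.1).1 hvP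
    obtain ⟨z', hz'⟩ := inner_fcc_slot_half_int hq hs
    -- `G₀⁻¹(v.1 − t₁) = q + G₀⁻¹(t₂ − t₁)`
    have e : (F []).symm (v.1 - t₁) = q + (F []).symm (t₂ - t₁) := by
      rw [← hpq, show F [] q + t₂ - t₁ = F [] q + (t₂ - t₁) by abel, map_add, LinearIsometryEquiv.symm_apply_apply]
    rw [e, inner_add_left, hz'] at hz
    exact hskew (z - z') (by push_cast; linarith)
  -- the abstract band-free count
  have key := word_sources_le_of_stateInvariant (root := root) (G₂ := F []) (P := Ps) hg hc hX hd hdn hmirror hinv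
    hdnext hW hmult (fun v _ => hf_full v) (fun v _ => hf_cross v) (fun v _ => hf_glide v)
    (fun κ hκ => hrig κ root hκ) hup hPsrc hPfull hPcross hPtop hR₀ hρ hcell hP₁X hP₂X hP₁ hP' hP'full hP₂
  exact key

end Instance

end Summit.Ventures.Crystal3D.Theorems

end
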